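import Mathlib
import Summits.Parity.BatemanHorn.Theorems.PolynomialMobiusPolyMobiusTailStubPairCornerMainBound
import HarnessLib

/-!
# Crux `PolyMobiusTail` (stmt-Parity-0870), line `eta-free-multilinear-window`:
# helper for `stub_pair_corner` — the ONE-SIDED corner of the linear pair window is `o(x)`

Aux stub `stub_pair_corner_oneSided`: for linear forms `P(n) = q₀ n + a₀`, `R(n) = q₁ n + a₁`
(`q₀, q₁ ≥ 1`, `gcd(q₁, a₁) = 1`, `q₁ a₀ - q₀ a₁ ≠ 0`) and `σ, η > 0` with `3σ + η < 1` (any `θ`),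

  `∑_{n ≤ x} ∑_{d ∣ P(n)} ∑_{b ∣ R(n)} 𝟙[x^{1-η} < d b ≤ x^{1+θ}, d ≤ x^σ] μ(d) log d · μ(b) log b = o(x)`:

the `n < |a₀| + |a₁| + 1` contribute `O(1)` and the rest is `O(x / log x)`
(`stub_pair_corner_mainBound`: divisor switch + Bombieri–Vinogradov for `μ`).
-/


open scoped BigOperators
open Filter Finset Asymptotics

namespace Summit.Parity.BatemanHorn.Theorems.PolyMobiusTail.EtaFreeWindow

/-- **Aux stub `stub_pair_corner_oneSided` (helper for `stub_pair_corner`, line eta-free-multilinear-window):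
the ONE-SIDED corner of the linear pair window is `o(x)`.**  For linear forms `P(n) = q₀ n + a₀`,
`R(n) = q₁ n + a₁` (`q₀, q₁ ≥ 1`, `gcd(q₁, a₁) = 1`, `q₁ a₀ - q₀ a₁ ≠ 0`) and `σ, η > 0` with
`3σ + η < 1` (any `θ`),
`∑_{n ≤ x} ∑_{d ∣ P(n)} ∑_{b ∣ R(n)} 𝟙[x^{1-η} < d b ≤ x^{1+θ}, d ≤ x^σ] μ(d) log d · μ(b) log b = o(x)`:
the `n < |a₀| + |a₁| + 1` contribute `O(1)`, the rest is `O(x / log x)` (`stub_pair_corner_mainBound`,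
Bombieri–Vinogradov for `μ` after the divisor switch). [folklore] -/
theorem stub_pair_corner_oneSided : ∀ (q₀ q₁ : ℕ) (a₀ a₁ : ℤ), 0 < q₀ → 0 < q₁ →
    Int.gcd (q₁ : ℤ) a₁ = 1 → (q₁ : ℤ) * a₀ - (q₀ : ℤ) * a₁ ≠ 0 → ∀ (σ η θ : ℝ), 0 < σ → 0 < η →
    3 * σ + η < 1 →
    (fun x : ℕ => ∑ n ∈ Finset.Icc 1 x, ∑ d ∈ (((q₀ : ℤ) * n + a₀).toNat).divisors, ∑ b ∈ (((q₁ : ℤ) * n + a₁).toNat).divisors, (if ((x : ℝ) ^ (1 - η) < (d : ℝ) * (b : ℝ) ∧ (d : ℝ) * (b : ℝ) ≤ (x : ℝ) ^ (1 + θ) ∧ (d : ℝ) ≤ (x : ℝ) ^ σ) then (ArithmeticFunction.moebius d : ℝ) * Real.log d * ((ArithmeticFunction.moebius b : ℝ) * Real.log b) else 0)) =o[Filter.atTop] fun x : ℕ => (x : ℝ) := by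
  intro q₀ q₁ a₀ a₁ hq₀ hq₁ hcop hΔ σ η θ hσ hη h3
  obtain ⟨K, x₁, hK⟩ := stub_pair_corner_mainBound q₀ q₁ a₀ a₁ hq₀ hq₁ hcop hΔ σ η θ hσ hη h3
  set n₁ : ℕ := (a₀.natAbs + a₁.natAbs + 1) with hn₁def
  have hn₁ : 1 ≤ n₁ := by omega
  -- the initial segment `n < n₁` is bounded independently of `x`
  set K₀ : ℝ := ∑ n ∈ Finset.Ico 1 n₁, ∑ d ∈ (((q₀ : ℤ) * n + a₀).toNat).divisors,
    ∑ b ∈ (((q₁ : ℤ) * n + a₁).toNat).divisors, |(ArithmeticFunction.moebius d : ℝ) * Real.log d * ((ArithmeticFunction.moebius b : ℝ) * Real.log b)| with hK₀def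
  have hsmall : ∀ x : ℕ, |∑ n ∈ Finset.Ico 1 n₁, ∑ d ∈ (((q₀ : ℤ) * n + a₀).toNat).divisors, ∑ b ∈ (((q₁ : ℤ) * n + a₁).toNat).divisors, (if ((x : ℝ) ^ (1 - η) < (d : ℝ) * (b : ℝ) ∧ (d : ℝ) * (b : ℝ) ≤ (x : ℝ) ^ (1 + θ) ∧ (d : ℝ) ≤ (x : ℝ) ^ σ) then (ArithmeticFunction.moebius d : ℝ) * Real.log d * ((ArithmeticFunction.moebius b : ℝ) * Real.log b) else 0)| ≤ K₀ := by
    intro x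
    refine (Finset.abs_sum_le_sum_abs _ _).trans (Finset.sum_le_sum fun n _ => ?_)
    refine (Finset.abs_sum_le_sum_abs _ _).trans (Finset.sum_le_sum fun d _ => ?_)
    refine (Finset.abs_sum_le_sum_abs _ _).trans (Finset.sum_le_sum fun b _ => ?_)
    split_ifs
    · exact le_rfl
    · rw [abs_zero]; exact abs_nonneg _
  have hsplit : ∀ x : ℕ, n₁ ≤ x → ∑ n ∈ Finset.Icc 1 x, ∑ d ∈ (((q₀ : ℤ) * n + a₀).toNat).divisors, ∑ b ∈ (((q₁ : ℤ) * n + a₁).toNat).divisors, (if ((x : ℝ) ^ (1 - η) < (d : ℝ) * (b : ℝ) ∧ (d : ℝ) * (b : ℝ) ≤ (x : ℝ) ^ (1 + θ) ∧ (d : ℝ) ≤ (x : ℝ) ^ σ) then (ArithmeticFunction.moebius d : ℝ) * Real.log d * ((ArithmeticFunction.moebius b : ℝ) * Real.log b) else 0) =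
      ∑ n ∈ Finset.Ico 1 n₁, ∑ d ∈ (((q₀ : ℤ) * n + a₀).toNat).divisors, ∑ b ∈ (((q₁ : ℤ) * n + a₁).toNat).divisors, (if ((x : ℝ) ^ (1 - η) < (d : ℝ) * (b : ℝ) ∧ (d : ℝ) * (b : ℝ) ≤ (x : ℝ) ^ (1 + θ) ∧ (d : ℝ) ≤ (x : ℝ) ^ σ) then (ArithmeticFunction.moebius d : ℝ) * Real.log d * ((ArithmeticFunction.moebius b : ℝ) * Real.log b) else 0) + ∑ n ∈ Finset.Icc n₁ x, ∑ d ∈ (((q₀ : ℤ) * n + a₀).toNat).divisors, ∑ b ∈ (((q₁ : ℤ) * n + a₁).toNat).divisors, (if ((x : ℝ) ^ (1 - η) < (d : ℝ) * (b : ℝ) ∧ (d : ℝ) * (b : ℝ) ≤ (x : ℝ) ^ (1 + θ) ∧ (d : ℝ) ≤ (x : ℝ) ^ σ) then (ArithmeticFunction.moebius d : ℝ) * Real.log d * ((ArithmeticFunction.moebius b : ℝ) * Real.log b) else 0) := by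
    intro x hx
    rw [← Finset.Ico_add_one_right_eq_Icc 1 x, ← Finset.Ico_add_one_right_eq_Icc n₁ x,
      ← Finset.sum_Ico_consecutive _ hn₁ (by omega : n₁ ≤ x + 1)]
  -- assemble the `o(x)` bound
  refine Asymptotics.IsLittleO.of_bound fun ε hε => ?_
  have hlog : Tendsto (fun x : ℕ => Real.log (x : ℝ)) atTop atTop :=
    Real.tendsto_log_atTop.comp tendsto_natCast_atTop_atTop
  filter_upwards [eventually_ge_atTop n₁, tendsto_natCast_atTop_atTop.eventually_ge_atTop x₁,
    tendsto_natCast_atTop_atTop.eventually_ge_atTop (2 * K₀ / ε),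
    tendsto_natCast_atTop_atTop.eventually_ge_atTop (1 : ℝ),
    hlog.eventually_ge_atTop (2 * |K| / ε + 1)] with x hxn₁ hxx₁ hxK₀ hx1 hxlog
  rw [Real.norm_eq_abs, Real.norm_eq_abs, abs_of_nonneg (Nat.cast_nonneg x : (0 : ℝ) ≤ (x : ℝ)),
    hsplit x hxn₁]
  have hlog0 : 0 < Real.log x := by
    have : 0 ≤ 2 * |K| / ε := by positivity
    linarith
  have hx0 : (0 : ℝ) ≤ x := Nat.cast_nonneg x
  have h1 : |∑ n ∈ Finset.Ico 1 n₁, ∑ d ∈ (((q₀ : ℤ) * n + a₀).toNat).divisors, ∑ b ∈ (((q₁ : ℤ) * n + a₁).toNat).divisors, (if ((x : ℝ) ^ (1 - η) < (d : ℝ) * (b : ℝ) ∧ (d : ℝ) * (b : ℝ) ≤ (x : ℝ) ^ (1 + θ) ∧ (d : ℝ) ≤ (x : ℝ) ^ σ) then (ArithmeticFunction.moebius d : ℝ) * Real.log d * ((ArithmeticFunction.moebius b : ℝ) * Real.log b) else 0)| ≤ ε / 2 * x := by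
    refine (hsmall x).trans ?_
    have : 2 * K₀ / ε ≤ x := hxK₀
    rw [div_le_iff₀ hε] at this
    linarith
  have h2 : |∑ n ∈ Finset.Icc n₁ x, ∑ d ∈ (((q₀ : ℤ) * n + a₀).toNat).divisors, ∑ b ∈ (((q₁ : ℤ) * n + a₁).toNat).divisors, (if ((x : ℝ) ^ (1 - η) < (d : ℝ) * (b : ℝ) ∧ (d : ℝ) * (b : ℝ) ≤ (x : ℝ) ^ (1 + θ) ∧ (d : ℝ) ≤ (x : ℝ) ^ σ) then (ArithmeticFunction.moebius d : ℝ) * Real.log d * ((ArithmeticFunction.moebius b : ℝ) * Real.log b) else 0)| ≤ ε / 2 * x := by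
    refine (hK x hxx₁).trans ?_
    have hKle : K * (x : ℝ) / Real.log x ≤ |K| * x / Real.log x :=
      div_le_div_of_nonneg_right (mul_le_mul_of_nonneg_right (le_abs_self K) hx0) hlog0.le
    refine hKle.trans ?_
    rw [div_le_iff₀ hlog0]
    have h3 : 2 * |K| / ε ≤ Real.log x := by linarith
    rw [div_le_iff₀ hε] at h3
    have h4 : |K| * (x : ℝ) * 2 ≤ ε * Real.log x * x := by
      have := mul_le_mul_of_nonneg_right h3 hx0
      linarith
    linarith
  calc |∑ n ∈ Finset.Ico 1 n₁, ∑ d ∈ (((q₀ : ℤ) * n + a₀).toNat).divisors, ∑ b ∈ (((q₁ : ℤ) * n + a₁).toNat).divisors, (if ((x : ℝ) ^ (1 - η) < (d : ℝ) * (b : ℝ) ∧ (d : ℝ) * (b : ℝ) ≤ (x : ℝ) ^ (1 + θ) ∧ (d : ℝ) ≤ (x : ℝ) ^ σ) then (ArithmeticFunction.moebius d : ℝ) * Real.log d * ((ArithmeticFunction.moebius b : ℝ) * Real.log b) else 0) + ∑ n ∈ Finset.Icc n₁ x, ∑ d ∈ (((q₀ : ℤ) * n + a₀).toNat).divisors,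 ∑ b ∈ (((q₁ : ℤ) * n + a₁).toNat).divisors, (if ((x : ℝ) ^ (1 - η) < (d : ℝ) * (b : ℝ) ∧ (d : ℝ) * (b : ℝ) ≤ (x : ℝ) ^ (1 + θ) ∧ (d : ℝ) ≤ (x : ℝ) ^ σ) then (ArithmeticFunction.moebius d : ℝ) * Real.log d * ((ArithmeticFunction.moebius b : ℝ) * Real.log b) else 0)|
      ≤ |∑ n ∈ Finset.Ico 1 n₁, ∑ d ∈ (((q₀ : ℤ) * n + a₀).toNat).divisors, ∑ b ∈ (((q₁ : ℤ) * n + a₁).toNat).divisors, (if ((x : ℝ) ^ (1 - η) < (d : ℝ) * (b : ℝ) ∧ (d : ℝ) * (b : ℝ) ≤ (x : ℝ) ^ (1 + θ) ∧ (d : ℝ) ≤ (x : ℝ) ^ σ) then (ArithmeticFunction.moebius d : ℝ) * Real.log d * ((ArithmeticFunction.moebius b : ℝ) * Real.log b) else 0)| + |∑ n ∈ Finset.Icc n₁ x, ∑ d ∈ (((q₀ : ℤ) * n + a₀).toNat).divisors, ∑ b ∈ (((q₁ : ℤ) * n + a₁).toNat).divisors, (if ((x : ℝ) ^ (1 - η)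 < (d : ℝ) * (b : ℝ) ∧ (d : ℝ) * (b : ℝ) ≤ (x : ℝ) ^ (1 + θ) ∧ (d : ℝ) ≤ (x : ℝ) ^ σ) then (ArithmeticFunction.moebius d : ℝ) * Real.log d * ((ArithmeticFunction.moebius b : ℝ) * Real.log b) else 0)| := abs_add_le _ _
    _ ≤ ε / 2 * x + ε / 2 * x := add_le_add h1 h2
    _ = ε * x := by ring

end Summit.Parity.BatemanHorn.Theorems.PolyMobiusTail.EtaFreeWindow
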